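import Summits.BirchSwinnertonDyer.BirchSwinnertonDyer.Theorems.Rank2ObservatoryRank3TwoDescCensusFinal
import Summits.BirchSwinnertonDyer.BirchSwinnertonDyer.Theorems.Rank2ObservatoryRank3TwoDescCensusPart11
import Summits.BirchSwinnertonDyer.BirchSwinnertonDyer.Theorems.Rank2ObservatoryRank3TwoDescCensusPart12
import Summits.BirchSwinnertonDyer.BirchSwinnertonDyer.Theorems.Rank2ObservatoryRank3TwoDescCensusPart13
import Summits.BirchSwinnertonDyer.BirchSwinnertonDyer.Theorems.Rank2ObservatoryRank3TwoDescCensusPart14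
import Summits.BirchSwinnertonDyer.BirchSwinnertonDyer.Theorems.Rank2ObservatoryRank3TwoDescCensusPart15
import Summits.BirchSwinnertonDyer.BirchSwinnertonDyer.Theorems.Rank2ObservatoryRank3TwoDescCensusPart16
import Summits.BirchSwinnertonDyer.BirchSwinnertonDyer.Theorems.Rank2ObservatoryRank3TwoDescCensusPart17
import Summits.BirchSwinnertonDyer.BirchSwinnertonDyer.Theorems.Rank2ObservatoryRank3TwoDescCensusPart18
import Summits.BirchSwinnertonDyer.BirchSwinnertonDyer.Theorems.Rank2ObservatoryRank3TwoDescCensusPart19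
import Summits.BirchSwinnertonDyer.BirchSwinnertonDyer.Theorems.Rank2ObservatoryRank3TwoDescCensusPart20
import Summits.BirchSwinnertonDyer.BirchSwinnertonDyer.Theorems.Rank2ObservatoryRank3TwoDescCensusPart21
import Summits.BirchSwinnertonDyer.BirchSwinnertonDyer.Theorems.Rank2ObservatoryRank3TwoDescCensusPart22
import Summits.BirchSwinnertonDyer.BirchSwinnertonDyer.Theorems.Rank2ObservatoryRank3TwoDescCensusPart23
import Summits.BirchSwinnertonDyer.BirchSwinnertonDyer.Theorems.Rank2ObservatoryRank3TwoDescCensusPart24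
import Summits.BirchSwinnertonDyer.BirchSwinnertonDyer.Theorems.Rank2ObservatoryRank3TwoDescCensusPart25
import Summits.BirchSwinnertonDyer.BirchSwinnertonDyer.Theorems.Rank2ObservatoryRank3TwoDescCensusPart26
import Summits.BirchSwinnertonDyer.BirchSwinnertonDyer.Theorems.Rank2ObservatoryRank3TwoDescCensusPart27
import Summits.BirchSwinnertonDyer.BirchSwinnertonDyer.Theorems.Rank2ObservatoryRank3TwoDescCensusPart28
import Summits.BirchSwinnertonDyer.BirchSwinnertonDyer.Theorems.Rank2ObservatoryRank3TwoDescCensusPart29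
import Summits.BirchSwinnertonDyer.BirchSwinnertonDyer.Theorems.Rank2ObservatoryRank3TwoDescCensusPart30
import Summits.BirchSwinnertonDyer.BirchSwinnertonDyer.Theorems.Rank2ObservatoryRank3TwoDescCensusPart31
import Summits.BirchSwinnertonDyer.BirchSwinnertonDyer.Theorems.Rank2ObservatoryRank3TwoDescCensusPart32
import Summits.BirchSwinnertonDyer.BirchSwinnertonDyer.Theorems.Rank2ObservatoryRank3TwoDescCensusPart33
import Summits.BirchSwinnertonDyer.BirchSwinnertonDyer.Theorems.Rank2ObservatoryRank3TwoDescCensusPart34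
import Summits.BirchSwinnertonDyer.BirchSwinnertonDyer.Theorems.Rank2ObservatoryRank3IsoCensusPart1
import Summits.BirchSwinnertonDyer.BirchSwinnertonDyer.Theorems.Rank2ObservatoryRank3IsoCensusPart2
import Summits.BirchSwinnertonDyer.BirchSwinnertonDyer.Theorems.Rank2ObservatoryRank3FullTwoTorsion
import HarnessLib

/-!
# BirchSwinnertonDyer — rank ≥ 2 observatory: rank-3 CENSUS, one statement over ALL 9361 kernel-ranked rows of `rank3Table` (`rank_ℤ = 3` hypothesis-free)

HONEST FRAMING: per-curve certified theorems and census instruments; no claim on BSD in rank ≥ 2.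

`Rank3KernelRankCensusN9361.rows` (DATA) = `TwoDescRank3Census.Final.rows ++ TwoDescRank3Census.Part11.rows ++ TwoDescRank3Census.Part12.rows ++ TwoDescRank3Census.Part13.rows ++ TwoDescRank3Census.Part14.rows ++ TwoDescRank3Census.Part15.rows ++ TwoDescRank3Census.Part16.rows ++ TwoDescRank3Census.Part17.rows ++ TwoDescRank3Census.Part18.rows ++ TwoDescRank3Census.Part19.rows ++ TwoDescRank3Census.Part20.rows ++ TwoDescRank3Census.Part21.rows ++ TwoDescRank3Census.Part22.rows ++ TwoDescRank3Census.Part23.rows ++ TwoDescRank3Census.Part24.rows ++ TwoDescRank3Census.Part25.rows ++ TwoDescRank3Census.Part26.rows ++ TwoDescRank3Census.Part27.rows ++ TwoDescRank3Census.Part28.rows ++ TwoDescRank3Census.Part29.rows ++ TwoDescRank3Census.Part30.rows ++ TwoDescRank3Census.Part31.rows ++ TwoDescRank3Census.Part32.rows ++ TwoDescRank3Census.Part33.rows ++ TwoDescRank3Census.Part34.rows ++ IsoRank3Census.Part1.rows ++ IsoRank3Census.Part2.rows ++ rank3FullTwoTorsionRows` lists the 9361 rows of the rank-3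
census table `rank3Table` (9 487 curves of conductor `< 5·10⁵` with analytic rank 3 in Cremona's table) whose Mordell–Weil rank is
decided IN THE KERNEL with NO hypothesis, by the three instruments of the observatory:
* 8375 odd-torsion rows — KERNEL-2DESC (`Rank2ObservatoryRank3TwoDescCensus` `Final (993)` + `Part11 (447)` + `Part12 (470)` + `Part13 (546)` + `Part14 (206)` + `Part15 (231)` + `Part16 (346)` + `Part17 (278)` + `Part18 (142)` + `Part19 (47)` + `Part20 (91)` + `Part21 (266)` + `Part22 (490)` + `Part23 (459)` + `Part24 (153)` + `Part25 (490)` + `Part26 (471)` + `Part27 (310)` + `Part28 (450)` + `Part29 (410)` + `Part30 (432)` + `Part31 (432)` + `Part32 (59)` + `Part33 (96)` + `Part34 (60)`: general 2-descent over the cubic 2-division field,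
  Cassels' `x − θ` map, fewer than `2⁴` admissible classes counted by `decide`; per-curve files, PID waves, class-group-general waves);
* 966 rows with one rational 2-torsion point — KERNEL-ISO (`Rank2ObservatoryRank3IsoCensusPart1/2` over
  `Rank2ObservatoryRank3IsoCensus`: descent via 2-isogeny, `IsoRow.check3` by `decide`);
* 20 rows with full rational 2-torsion — complete 2-descent per curve (`Rank2ObservatoryRank3FullTwoTorsion`).
The three families are disjoint by their 2-torsion structure and duplicate-free by construction (not re-checked here).  In every case the
lower bound `3 ≤ rank_ℤ` is the kernel height-pairing / reduction point certificate of the census.  THEOREMS (all glued by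
`List.forall_mem_append` from the landed statements; nothing is re-certified here): `mem_rank3Table`, `rank_eq_three : ∀ r ∈ rows,
rank_ℤ(E_r(ℚ)) = 3` — NO hypothesis; `rows_length : rows.length = 9361`; and the census corollaries `lvalues_eq_zero`
(`L(E_r,1) = L′(E_r,1) = 0` given ONLY Gross–Zagier–Kolyvagin `hGZK` = bsd.S17) and `analyticRank_eq_three` (`r_an = rank_ℤ = 3` given
`hGZK` and, per row, `L‴(E_r,1) ≠ 0`, `w(E_r) = −1`).  Sorry-free; no new axioms.
The other 126 rows of `rank3Table` (odd torsion, 2-descent bound not yet a kernel theorem) keep the upper bound as the named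
hypothesis `hup` of the census theorems (`Rank2ObservatoryRank3KernelCensus`).
References: J. W. S. Cassels, *Lectures on Elliptic Curves* (1991) §15; J. E. Cremona, *Algorithms for Modular Elliptic Curves*
(2nd ed. 1997) Tables, §2.13, §3.5, §3.6; J. H. Silverman, J. Tate, *Rational Points on Elliptic Curves* (2nd ed. 2015) §3.6;
H. Darmon, *Rational Points on Modular Elliptic Curves* (2004) Thm. 3.22.
-/

-- single-conjunct summit: `Summit.BirchSwinnertonDyer.BirchSwinnertonDyer.…` repeats the name by design
set_option linter.dupNamespace false
-- deep literal lists behind the part definitions: raise the recursion budget for the whole file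
set_option maxRecDepth 400000

namespace Summit.BirchSwinnertonDyer.BirchSwinnertonDyer.Rank2Observatory.Rank3KernelRankCensusN9361

open Literature Literature.NumberTheory.EllipticCurves WeierstrassCurve

/-- `∀`-over-membership is additive under `++`. [folklore] -/
private theorem forall_app {P : Rank3Row → Prop} {l₁ l₂ : List Rank3Row} (h₁ : ∀ r ∈ l₁, P r) (h₂ : ∀ r ∈ l₂, P r) :
    ∀ r ∈ l₁ ++ l₂, P r :=
  List.forall_mem_append.2 ⟨h₁, h₂⟩

/-- DATA: all 9361 kernel-ranked rows = KERNEL-2DESC (993 + 447 + 470 + 546 + 206 + 231 + 346 + 278 + 142 + 47 + 91 + 266 + 490 + 459 + 153 + 490 + 471 + 310 + 450 + 410 + 432 + 432 + 59 + 96 + 60 = 8375) ++ KERNEL-ISO (483 + 483) ++ full 2-torsion (20). [cite: CremonaAlgorithms1997, Tables] -/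
def rows : List Rank3Row :=
  TwoDescRank3Census.Final.rows ++ TwoDescRank3Census.Part11.rows ++ TwoDescRank3Census.Part12.rows ++ TwoDescRank3Census.Part13.rows ++ TwoDescRank3Census.Part14.rows ++ TwoDescRank3Census.Part15.rows ++ TwoDescRank3Census.Part16.rows ++ TwoDescRank3Census.Part17.rows ++ TwoDescRank3Census.Part18.rows ++ TwoDescRank3Census.Part19.rows ++ TwoDescRank3Census.Part20.rows ++ TwoDescRank3Census.Part21.rows ++ TwoDescRank3Census.Part22.rows ++ TwoDescRank3Census.Part23.rows ++ TwoDescRank3Census.Part24.rows ++ TwoDescRank3Census.Part25.rows ++ TwoDescRank3Census.Part26.rows ++ TwoDescRank3Census.Part27.rows ++ TwoDescRank3Census.Part28.rows ++ TwoDescRank3Census.Part29.rows ++ TwoDescRank3Census.Part30.rows ++ TwoDescRank3Census.Part31.rows ++ TwoDescRank3Census.Part32.rows ++ TwoDescRank3Census.Part33.rows ++ TwoDescRank3Census.Part34.rows ++ IsoRank3Census.Part1.rows ++ IsoRank3Census.Part2.rows ++ rank3FullTwoTorsionRows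

/-- `rows.length = 9361` (= 993 + 447 + 470 + 546 + 206 + 231 + 346 + 278 + 142 + 47 + 91 + 266 + 490 + 459 + 153 + 490 + 471 + 310 + 450 + 410 + 432 + 432 + 59 + 96 + 60 + 483 + 483 + 20). -/
theorem rows_length : rows.length = 9361 := by
  simp only [rows, List.length_append, TwoDescRank3Census.Final.rows_length, TwoDescRank3Census.Part11.rows_length, TwoDescRank3Census.Part12.rows_length, TwoDescRank3Census.Part13.rows_length, TwoDescRank3Census.Part14.rows_length, TwoDescRank3Census.Part15.rows_length, TwoDescRank3Census.Part16.rows_length, TwoDescRank3Census.Part17.rows_length, TwoDescRank3Census.Part18.rows_length, TwoDescRank3Census.Part19.rows_length, TwoDescRank3Census.Part20.rows_length, TwoDescRank3Census.Part21.rows_length, TwoDescRank3Census.Part22.rows_length, TwoDescRank3Census.Part23.rows_length, TwoDescRank3Census.Part24.rows_length, TwoDescRank3Census.Part25.rows_length, TwoDescRank3Census.Part26.rows_length, TwoDescRank3Census.Part27.rows_length, TwoDescRank3Census.Part28.rows_length, TwoDescRank3Census.Part29.rows_length, TwoDescRank3Census.Part30.rows_length, TwoDescRank3Census.Part31.rows_length,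 TwoDescRank3Census.Part32.rows_length, TwoDescRank3Census.Part33.rows_length, TwoDescRank3Census.Part34.rows_length, IsoRank3Census.Part1.rows_length, IsoRank3Census.Part2.rows_length, rank3FullTwoTorsionRows_length]

/-- **Every listed row is a row of the census table `rank3Table`.** [cite: CremonaAlgorithms1997, Tables] -/
theorem mem_rank3Table : ∀ r ∈ rows, r ∈ rank3Table := by
  unfold rows
  exact forall_app (forall_app (forall_app (forall_app (forall_app (forall_app (forall_app (forall_app (forall_app (forall_app (forall_app (forall_app (forall_app (forall_app (forall_app (forall_app (forall_app (forall_app (forall_app (forall_app (forall_app (forall_app (forall_app (forall_app (forall_app (forall_app (forall_app TwoDescRank3Census.Final.mem_rank3Table TwoDescRank3Census.Part11.mem_rank3Table) TwoDescRank3Census.Part12.mem_rank3Table) TwoDescRank3Census.Part13.mem_rank3Table) TwoDescRank3Census.Part14.mem_rank3Table) TwoDescRank3Census.Part15.mem_rank3Table) TwoDescRank3Census.Part16.mem_rank3Table) TwoDescRank3Census.Part17.mem_rank3Table) TwoDescRank3Census.Part18.mem_rank3Table) TwoDescRank3Census.Part19.mem_rank3Table) TwoDescRank3Census.Part20.mem_rank3Table)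 TwoDescRank3Census.Part21.mem_rank3Table) TwoDescRank3Census.Part22.mem_rank3Table) TwoDescRank3Census.Part23.mem_rank3Table) TwoDescRank3Census.Part24.mem_rank3Table) TwoDescRank3Census.Part25.mem_rank3Table) TwoDescRank3Census.Part26.mem_rank3Table) TwoDescRank3Census.Part27.mem_rank3Table) TwoDescRank3Census.Part28.mem_rank3Table) TwoDescRank3Census.Part29.mem_rank3Table) TwoDescRank3Census.Part30.mem_rank3Table) TwoDescRank3Census.Part31.mem_rank3Table) TwoDescRank3Census.Part32.mem_rank3Table) TwoDescRank3Census.Part33.mem_rank3Table) TwoDescRank3Census.Part34.mem_rank3Table) IsoRank3Census.Part1.mem_rank3Table) IsoRank3Census.Part2.mem_rank3Table) mem_rank3Table_of_mem_fullTwoTorsionRows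

/-- **`rank_ℤ E_r(ℚ) = 3` for every one of the 9361 listed census rows, NO hypothesis.**
[cite: Cassels1991LecturesEllipticCurves, §15] [cite: SilvermanTate2015, §3.6] [cite: CremonaAlgorithms1997, §3.5, §3.6] -/
theorem rank_eq_three : ∀ r ∈ rows, r.curve.mordellWeilRank = 3 := by
  unfold rows
  exact forall_app (forall_app (forall_app (forall_app (forall_app (forall_app (forall_app (forall_app (forall_app (forall_app (forall_app (forall_app (forall_app (forall_app (forall_app (forall_app (forall_app (forall_app (forall_app (forall_app (forall_app (forall_app (forall_app (forall_app (forall_app (forall_app (forall_app TwoDescRank3Census.Final.rank_eq_three TwoDescRank3Census.Part11.rank_eq_three) TwoDescRank3Census.Part12.rank_eq_three) TwoDescRank3Census.Part13.rank_eq_three) TwoDescRank3Census.Part14.rank_eq_three) TwoDescRank3Census.Part15.rank_eq_three) TwoDescRank3Census.Part16.rank_eq_three) TwoDescRank3Census.Part17.rank_eq_three) TwoDescRank3Census.Part18.rank_eq_three) TwoDescRank3Census.Part19.rank_eq_three) TwoDescRank3Census.Part20.rank_eq_three) TwoDescRank3Census.Part21.rank_eq_three) TwoDescRank3Census.Part22.rank_eq_three)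 TwoDescRank3Census.Part23.rank_eq_three) TwoDescRank3Census.Part24.rank_eq_three) TwoDescRank3Census.Part25.rank_eq_three) TwoDescRank3Census.Part26.rank_eq_three) TwoDescRank3Census.Part27.rank_eq_three) TwoDescRank3Census.Part28.rank_eq_three) TwoDescRank3Census.Part29.rank_eq_three) TwoDescRank3Census.Part30.rank_eq_three) TwoDescRank3Census.Part31.rank_eq_three) TwoDescRank3Census.Part32.rank_eq_three) TwoDescRank3Census.Part33.rank_eq_three) TwoDescRank3Census.Part34.rank_eq_three) IsoRank3Census.Part1.rank_eq_three) IsoRank3Census.Part2.rank_eq_three) mordellWeilRank_eq_three_of_mem_fullTwoTorsionRows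

/-- Both facts per listed row. [cite: CremonaAlgorithms1997, Tables] -/
theorem rank_eq_three_and_mem : ∀ r ∈ rows, r ∈ rank3Table ∧ r.curve.mordellWeilRank = 3 :=
  fun r hr => ⟨mem_rank3Table r hr, rank_eq_three r hr⟩

/-- **`L(E_r,1) = 0` and `L′(E_r,1) = 0` exactly, for every one of the 9361 listed rows**, given ONLY Gross–Zagier–Kolyvagin
(`hGZK` = bsd.S17: `r_an ≤ 1 ⇒ rank_ℤ ≤ 1`); the rank input `3 ≤ rank_ℤ` is the kernel theorem `rank_eq_three`.
[cite: CremonaAlgorithms1997, §2.13] [cite: Darmon2004, Thm. 3.22] -/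
theorem lvalues_eq_zero (hGZK : rank_eq_analyticRank_of_analyticRank_le_one) :
    ∀ r ∈ rows, r.curve.entireLFunction 1 = 0 ∧ deriv r.curve.entireLFunction 1 = 0 :=
  fun r hr => Rank3Row.lvalues_eq_zero_of_three_le (mem_rank3Table r hr) hGZK (rank_eq_three r hr).ge

/-- **CENSUS THEOREM over all 9361 kernel-ranked rows: `r_an(E_r) = rank_ℤ E_r(ℚ) = 3`** with BOTH rank fields of the census
(`hlow : 3 ≤ rank_ℤ`, `hup : rank_ℤ ≤ 3`) DISCHARGED by the kernel (`rank_eq_three`); the ONLY remaining named hypotheses are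
Gross–Zagier–Kolyvagin `hGZK` (bsd.S17) and, per row, the engine-side certificate fields `L‴(E_r,1) ≠ 0` and `w(E_r) = −1`.
[cite: CremonaAlgorithms1997, §2.13] [cite: Darmon2004, Thm. 3.22] -/
theorem analyticRank_eq_three (hGZK : rank_eq_analyticRank_of_analyticRank_le_one) :
    ∀ r ∈ rows, iteratedDeriv 3 r.curve.entireLFunction 1 ≠ 0 → r.curve.rootNumber = -1 →
      r.curve.analyticRank = r.curve.mordellWeilRank ∧ r.curve.analyticRank = 3 := by
  intro r hr hL3 hw
  have h := Rank3Row.analyticRank_eq_rank_of_three_le (mem_rank3Table r hr) (rank_eq_three r hr).ge hGZK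
    (rank_eq_three r hr).le hL3 hw
  exact ⟨h, h.trans (rank_eq_three r hr)⟩

end Summit.BirchSwinnertonDyer.BirchSwinnertonDyer.Rank2Observatory.Rank3KernelRankCensusN9361
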